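/-
Copyright (c) 2026 the pub-hodgecm-mathlib formalisation cell (harness21).  Prover seat hodgecm-mathlib-B-p14 (g35): road «S3-tree» (LEAD F0P3a-plan (g11) WORD T10-2; architect A-p16 (g28)
census «S3» v3 = DEAL SHEET, acting architect F0P3-p01 (g16)), brick T1 «the `U(3)_v` tree», file T1c = SELF-DUAL FRAMES at `J₀` (★ `exists_frame_cartan` read in lattice-tree currency); 2026-09-01.
-/
import Literature.NumberTheory.Automorphic.UnitaryLatticeTreeTypes              -- ★ T1b-2 (B-p14 (g35))
import Literature.NumberTheory.Automorphic.HyperspecialUnitaryCartanFrames     -- ★ `UnramifiedLocalConjDatum.exists_frame_cartan`, `isUnimodularLattice_frameLattice`, `frame_univ`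
import HarnessLib

/-!
# The lattice graph of a hermitian space — IV: SELF-DUAL FRAMES — a self-dual vertex for `J₀` is a unimodular `B₀`-lattice, hence `k · latt (diagonal d)` with `k ∈ K₀`
# (★ `exists_frame_cartan`); at `N = 3` it is `k · latt diag(ϖ^a, 1, ϖ^{−a})` — the hyperspecial vertices of the `U(3)` tree are `K₀`-translates of the apartment (Tits 1979 §3.3.3; Bruhat–Tits 1972 §10)

Topic `NumberTheory/Automorphic`; namespace `Literature.NumberTheory.Automorphic.UnitaryLatticeTree`.  THEOREMS ONLY (no definition, no instance, no notation, no named fact,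
no `sorry`); kernel lane.  Cell `pub/hodgecm-mathlib` (D-0151), crux H413 = `stmt-HodgeConjecture-24833`; road «S3-tree» (census «S3» v3 §1 rulings A-49/A-53), brick **T1** over the
definitions ★ `UnitaryLatticeTreeDefs` (T1a; rank-`N` sibling of ★ `HermitianLatticeTree*`, `Valued K ℤᵐ⁰` currency).  HONEST LABEL: HC_CM is proved only modulo the 2 remaining named inputs (hLiu418 24832, h413 24833) until rung 0 closes; nothing printed is asserted here (elementary lattice
algebra over a valuation ring); S3 stays a print row until the road's END lands.

* §12 `isUnit_det_antidiagonal`, `span_latt_eq_top`, **`isUnimodularLattice_of_isSelfDualLattice`** (bridge: type `0` for `J₀` ⇒ ★ `IsUnimodularLattice (B₀ σ N) (frame K N univ)`).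
* §13 **`exists_frame_of_isSelfDualLattice`** ((F0), any `N`, `UnramifiedLocalConjDatum σ ϖ`: `M = k·latt (diagonal d)`, `k ∈ K₀`, `σd = d`, `d_i d_{rev i} = 1`).
* §14 `mem_latt_diagonal_iff`, `latt_diagonal_congr`, `scaleLattice_stdLattice_eq_latt_diagonal`, `scaleLattice_pow_stdLattice_le_latt_diagonal_iff`, **`latticeDepth_latt_diagonal`**,
  **`exists_frame_three_of_isSelfDualLattice`** (`N = 3`: `M = k·latt diag(ϖ^a, 1, ϖ^{−a})`, `a ∈ ℤ`).

## References
* [BruhatTits1972] F. Bruhat, J. Tits, *Groupes réductifs sur un corps local I*, Publ. Math. IHÉS 41 (1972), §10 (the building of a rank-one group is a tree).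
* [Tits1979] J. Tits, *Reductive groups over local fields*, PSPM 33.1 (1979), §3.3.3 (hyperspecial `K₀ = 𝒢(𝒪)`), §2.4 (quasi-split unitary groups).
* [Serre1980Trees] J.-P. Serre, *Trees* (1980), Ch. II §1.1 (the tree of `SL₂`: lattices, adjacency, distance from a base lattice).
* [Jacobowitz1962] R. Jacobowitz, *Hermitian forms over local fields*, Amer. J. Math. 84 (1962), §4, §7–§8 (Gram matrices, unimodular and `𝔭`-modular hermitian lattices).
* [Omeara1963] O. T. O'Meara, *Introduction to Quadratic Forms* (1963), §82F (primitive vectors, unimodular lattices).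
-/

set_option autoImplicit false

noncomputable section

open scoped Valued WithZero Matrix MatrixGroups

namespace Literature.NumberTheory.Automorphic.UnitaryLatticeTree

open Literature.NumberTheory.Automorphic Literature.NumberTheory.Automorphic.HermitianLattice
open Literature.NumberTheory.Automorphic.CartanUnique

variable {K : Type*} [Field K] [Valued K ℤᵐ⁰] {σ : K →+* K} {ϖ : K} {N : ℕ}

/-! ## §12 A self-dual vertex for `J₀` is a unimodular lattice for ★ `B₀` (bridge to ★ `exists_frame_cartan`) -/

omit [Valued K ℤᵐ⁰] in
/-- `det J₀` is a unit. [cite: Tits1979, §3.3.3] -/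
theorem isUnit_det_antidiagonal : IsUnit ((StdForm.antidiagonal N).over K).det :=
  (Matrix.isUnit_iff_isUnit_det _).1 ((StdForm.antidiagonal N).isUnit_over K)

/-- `K^N` is spanned over `K` by `latt g` (`g` invertible). [cite: Serre1980Trees, II.1.1] -/
theorem span_latt_eq_top (hvσ : ∀ a, Valued.v (σ a) = Valued.v a) (g : GL (Fin N) K) :
    Submodule.span K (latt (g : Matrix (Fin N) (Fin N) K) : Set (Fin N → K)) = ⊤ := by
  have hrev : ∀ i ∈ (Finset.univ : Finset (Fin N)), Fin.rev i ∈ Finset.univ := fun _ _ => Finset.mem_univ _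
  have hL := isUnimodularLattice_frameLattice (K := K) (N := N) (σ := σ) hvσ hrev
  have hspan : Submodule.span K (stdLattice K N : Set (Fin N → K)) = ⊤ := by rw [← frameLattice_univ, hL.span_eq, frame_univ]
  rw [latt, Submodule.map_coe, LinearMap.coe_restrictScalars, Submodule.span_image, hspan, Submodule.map_top, LinearMap.range_eq_top]
  intro x
  exact ⟨((g⁻¹ : GL (Fin N) K) : Matrix (Fin N) (Fin N) K).mulVec x, by
    rw [Matrix.toLin'_apply, Matrix.mulVec_mulVec, ← Units.val_mul, mul_inv_cancel, Units.val_one, Matrix.one_mulVec]⟩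

/-- **BRIDGE: a self-dual vertex `latt g` for `J₀` is a unimodular lattice for `B₀` in `K^N`** (★ `IsUnimodularLattice (B₀ σ N) (frame K N univ)`), `σ` valuation-preserving.
[cite: Jacobowitz1962, §7] [cite: Omeara1963, §82F] -/
theorem isUnimodularLattice_of_isSelfDualLattice (hvσ : ∀ a, Valued.v (σ a) = Valued.v a) {M : Submodule 𝒪[K] (Fin N → K)}
    (hM : IsSelfDualLattice σ ϖ ((StdForm.antidiagonal N).over K) M) : IsUnimodularLattice (B₀ σ N) (frame K N Finset.univ) M := by
  obtain ⟨g, rfl, hG, -, hdet⟩ := hM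
  rw [pow_zero] at hdet
  have hrev : ∀ i ∈ (Finset.univ : Finset (Fin N)), Fin.rev i ∈ Finset.univ := fun _ _ => Finset.mem_univ _
  have hL := isUnimodularLattice_frameLattice (K := K) (N := N) (σ := σ) hvσ hrev
  refine ⟨?_, ?_, ?_, ?_⟩
  · rw [latt, ← frameLattice_univ]; exact hL.fg.map _
  · rw [frame_univ]; exact span_latt_eq_top hvσ g
  · intro x hx y hy
    rw [← pairing_antidiagonal]
    exact (latt_le_dualLatt_latt_iff σ hvσ _ _).2 hG hy x hx
  · intro z _ hz
    have hzd : z ∈ dualLatt σ ((StdForm.antidiagonal N).over K) (latt (g : Matrix (Fin N) (Fin N) K)) := fun x hx => by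
      rw [pairing_antidiagonal]; exact hz x hx
    rw [dualLatt_latt σ hvσ isUnit_det_antidiagonal g] at hzd
    exact (latt_mul_le_latt_iff (Matrix.isUnits_det_units g) _).2 (isIntMatrix_nonsing_inv_of_v_det_eq_one hG hdet) hzd

/-! ## §13 (F0) THE SELF-DUAL FRAME: `M = k · latt (diagonal d)` with `k ∈ K₀`, `σd = d`, `d_i d_{rev i} = 1` -/

/-- **(F0) FRAME OF A SELF-DUAL VERTEX** (`UnramifiedLocalConjDatum σ ϖ`, any `N`): every self-dual vertex for `J₀` is `k · latt (diagonal d)` with `k ∈ K₀ = U(J₀)(𝒪)` and a `σ`-fixed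
diagonal `d` with `d_i d_{rev i} = 1` — ★ `exists_frame_cartan` at `S = univ` read through the bridge §12 and ★ `exists_unitary_toLin_eq`.  At `N = 3`: `M = k · latt diag(ϖ^a, 1, ϖ^{−a})`
(§14). [cite: Tits1979, §3.3.3] [cite: BruhatTits1972, §10] -/
theorem exists_frame_of_isSelfDualLattice (hd : UnramifiedLocalConjDatum σ ϖ) {ϖ' : K} {M : Submodule 𝒪[K] (Fin N → K)}
    (hM : IsSelfDualLattice σ ϖ' ((StdForm.antidiagonal N).over K) M) :
    ∃ k : unitaryGroupOfForm σ ((StdForm.antidiagonal N).over K), k ∈ unitaryInt σ ((StdForm.antidiagonal N).over K) ∧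
      ∃ d : Fin N → K, (∀ i, σ (d i) = d i) ∧ (∀ i, d i * d (Fin.rev i) = 1) ∧ M = mapGL (k : GL (Fin N) K) (latt (Matrix.diagonal d)) := by
  have hrev : ∀ i ∈ (Finset.univ : Finset (Fin N)), Fin.rev i ∈ Finset.univ := fun _ _ => Finset.mem_univ _
  obtain ⟨ψ, d, hψiso, -, hψL, hdσ, hdinv, -, hEq⟩ := hd.exists_frame_cartan Finset.univ hrev M (isUnimodularLattice_of_isSelfDualLattice hd.vσ hM)
  obtain ⟨k, hk⟩ := exists_unitary_toLin_eq (σ := σ) ψ hψiso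
  refine ⟨k, mem_unitaryInt_of_map_stdLattice_eq (by rw [hk]; exact hψL), d, hdσ, hdinv, ?_⟩
  rw [hEq, frameLattice_univ, mapGL, hk]
  rfl

/-! ## §14 Diagonal lattices: membership, comparison with the scaled root, depth; the `N = 3` self-dual frame `diag(ϖ^a, 1, ϖ^{−a})` -/

/-- Membership in a diagonal lattice: `x ∈ latt (diagonal d) ↔ ∀ i, |x_i| ≤ |d_i|` (`d_i ≠ 0`). [cite: Serre1980Trees, II.1.1] -/
theorem mem_latt_diagonal_iff {d : Fin N → K} (hd : ∀ i, d i ≠ 0) (x : Fin N → K) : x ∈ latt (Matrix.diagonal d) ↔ ∀ i, Valued.v (x i) ≤ Valued.v (d i) := by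
  rw [latt, Submodule.mem_map]
  constructor
  · rintro ⟨u, hu, rfl⟩ i
    rw [LinearMap.restrictScalars_apply, Matrix.toLin'_apply, Matrix.mulVec_diagonal, map_mul]
    exact mul_le_of_le_one_right' (hu i)
  · intro h
    refine ⟨fun i => (d i)⁻¹ * x i, fun i => ?_, ?_⟩
    · change Valued.v ((d i)⁻¹ * x i) ≤ 1
      rw [map_mul, map_inv₀, ← div_eq_inv_mul, div_le_one₀ (zero_lt_iff.2 ((Valuation.ne_zero_iff _).2 (hd i)))]
      exact h i
    · rw [LinearMap.restrictScalars_apply, Matrix.toLin'_apply]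
      funext i
      rw [Matrix.mulVec_diagonal, ← mul_assoc, mul_inv_cancel₀ (hd i), one_mul]

/-- A diagonal lattice depends only on the valuations of the entries. [cite: Serre1980Trees, II.1.1] -/
theorem latt_diagonal_congr {d d' : Fin N → K} (hd : ∀ i, d i ≠ 0) (h : ∀ i, Valued.v (d i) = Valued.v (d' i)) : latt (Matrix.diagonal d) = latt (Matrix.diagonal d') := by
  have hd' : ∀ i, d' i ≠ 0 := fun i h0 => by have := h i; rw [h0, map_zero] at this; exact (Valuation.ne_zero_iff _).2 (hd i) this
  ext x
  rw [mem_latt_diagonal_iff hd, mem_latt_diagonal_iff hd']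
  simp only [h]

/-- The scaled root is a diagonal lattice: `c·𝒪^N = latt (diagonal (c,…,c))` (`c ≠ 0`). [cite: Serre1980Trees, II.1.1] -/
theorem scaleLattice_stdLattice_eq_latt_diagonal {c : K} (hc : c ≠ 0) : scaleLattice c (stdLattice K N) = latt (Matrix.diagonal fun _ : Fin N => c) := by
  ext x
  rw [mem_scaleLattice_stdLattice_iff hc, mem_latt_diagonal_iff fun _ => hc]

/-- `ϖ^j·𝒪^N ≤ latt (diagonal d)` iff `|ϖ^j| ≤ |d_i|` for all `i` (`ϖ, d_i ≠ 0`). [cite: Serre1980Trees, II.1.1] -/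
theorem scaleLattice_pow_stdLattice_le_latt_diagonal_iff (hϖ : ϖ ≠ 0) {d : Fin N → K} (hd : ∀ i, d i ≠ 0) (j : ℕ) :
    scaleLattice (ϖ ^ j) (stdLattice K N) ≤ latt (Matrix.diagonal d) ↔ ∀ i, Valued.v (ϖ ^ j) ≤ Valued.v (d i) := by
  rw [scaleLattice_stdLattice_eq_latt_diagonal (pow_ne_zero j hϖ)]
  constructor
  · intro h i
    have hcol : (Matrix.diagonal fun _ : Fin N => ϖ ^ j).mulVec (Pi.single i 1) ∈ latt (Matrix.diagonal d) := h (mulVec_single_mem_latt _ i)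
    rw [Matrix.mulVec_single_one] at hcol
    have := (mem_latt_diagonal_iff hd _).1 hcol i
    rwa [Matrix.col_apply, Matrix.diagonal_apply_eq] at this
  · intro h x hx
    rw [mem_latt_diagonal_iff (fun _ => pow_ne_zero j hϖ)] at hx
    exact (mem_latt_diagonal_iff hd x).2 fun i => (hx i).trans (h i)

/-- **DEPTH OF A DIAGONAL LATTICE** (`ϖ` a uniformiser): if `|d_i| = |ϖ|^{a_i}` (`a_i ∈ ℤ`) then `latticeDepth ϖ (latt (diagonal d)) = max(0, max_i a_i)` — in the form: the depth is the least
`k : ℕ` with `a_i ≤ k` for all `i`. [cite: Serre1980Trees, II.1.1] -/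
theorem latticeDepth_latt_diagonal (hϖ : Valued.v ϖ = WithZero.exp (-1 : ℤ)) {d : Fin N → K} {a : Fin N → ℤ} (ha : ∀ i, Valued.v (d i) = WithZero.exp (-a i)) (k : ℕ)
    (hk : ∀ i, a i ≤ k) (hmin : ∀ k' : ℕ, (∀ i, a i ≤ k') → k ≤ k') : latticeDepth ϖ (latt (Matrix.diagonal d)) = k := by
  have hϖ0 : ϖ ≠ 0 := fun h => by rw [h, map_zero] at hϖ; exact WithZero.coe_ne_zero hϖ.symm
  have hd : ∀ i, d i ≠ 0 := fun i h => by have := ha i; rw [h, map_zero] at this; exact WithZero.coe_ne_zero this.symm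
  have hiff : ∀ j : ℕ, scaleLattice (ϖ ^ j) (stdLattice K N) ≤ latt (Matrix.diagonal d) ↔ ∀ i, a i ≤ j := by
    intro j
    rw [scaleLattice_pow_stdLattice_le_latt_diagonal_iff hϖ0 hd]
    refine forall_congr' fun i => ?_
    rw [map_pow, hϖ, ha, ← WithZero.exp_nsmul, WithZero.exp_le_exp, nsmul_eq_mul, mul_neg, mul_one, neg_le_neg_iff]
  rw [latticeDepth]
  refine le_antisymm (Nat.sInf_le ((hiff k).2 hk)) ?_
  exact le_csInf ⟨k, (hiff k).2 hk⟩ fun j hj => hmin j ((hiff j).1 hj)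

/-- **THE `N = 3` SELF-DUAL FRAME**: under `UnramifiedLocalConjDatum σ ϖ`, every self-dual vertex of `(K³, J₀)` is `k · latt diag(ϖ^a, 1, ϖ^{−a})` for some `k ∈ K₀` and `a : ℤ` — the
hyperspecial vertices of the `U(3)` tree are `K₀`-translates of the apartment vertices `L_a`. [cite: BruhatTits1972, §10] [cite: Tits1979, §3.3.3] -/
theorem exists_frame_three_of_isSelfDualLattice (hd : UnramifiedLocalConjDatum σ ϖ) {ϖ' : K} {M : Submodule 𝒪[K] (Fin 3 → K)}
    (hM : IsSelfDualLattice σ ϖ' ((StdForm.antidiagonal 3).over K) M) :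
    ∃ k : unitaryGroupOfForm σ ((StdForm.antidiagonal 3).over K), k ∈ unitaryInt σ ((StdForm.antidiagonal 3).over K) ∧
      ∃ a : ℤ, M = mapGL (k : GL (Fin 3) K) (latt (Matrix.diagonal ![ϖ ^ a, 1, ϖ ^ (-a)])) := by
  obtain ⟨k, hk, d, hdσ, hdinv, rfl⟩ := exists_frame_of_isSelfDualLattice hd hM
  have hϖ0 : ϖ ≠ 0 := fun h => by have := hd.vϖ; rw [h, map_zero] at this; exact WithZero.coe_ne_zero this.symm
  have hd0 : ∀ i, d i ≠ 0 := fun i h => by have := hdinv i; rw [h, zero_mul] at this; exact zero_ne_one this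
  -- `a := -log |d 0|`, so that `|d 0| = |ϖ^a|`, `|d 1| = 1`, `|d 2| = |ϖ^{-a}|`
  set m : ℤ := WithZero.log (Valued.v (d 0)) with hm
  have hd0v : Valued.v (d 0) = WithZero.exp m := by rw [hm, WithZero.exp_log ((Valuation.ne_zero_iff _).2 (hd0 0))]
  have hd1 : Valued.v (d 1) = 1 := by
    have h11 : d 1 * d 1 = 1 := by have := hdinv 1; rwa [show Fin.rev (1 : Fin 3) = 1 from rfl] at this
    obtain ⟨m1, hm1⟩ : ∃ m1 : ℤ, Valued.v (d 1) = WithZero.exp m1 := ⟨_, (WithZero.exp_log ((Valuation.ne_zero_iff _).2 (hd0 1))).symm⟩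
    have hv : Valued.v (d 1) * Valued.v (d 1) = 1 := by rw [← map_mul, h11, map_one]
    rw [hm1, ← WithZero.exp_add, ← WithZero.exp_zero, WithZero.exp_inj] at hv
    rw [hm1, show m1 = 0 by omega, WithZero.exp_zero]
  have hd2 : Valued.v (d 2) = WithZero.exp (-m) := by
    have h02 : d 0 * d 2 = 1 := by have := hdinv 0; rwa [show Fin.rev (0 : Fin 3) = 2 from rfl] at this
    have hv : Valued.v (d 0) * Valued.v (d 2) = 1 := by rw [← map_mul, h02, map_one]
    rw [hd0v] at hv
    rw [WithZero.exp_neg, ← mul_eq_one_iff_eq_inv₀ WithZero.coe_ne_zero, mul_comm, hv]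
  refine ⟨k, hk, -m, ?_⟩
  congr 1
  refine latt_diagonal_congr hd0 fun i => ?_
  fin_cases i
  · simp only [Fin.zero_eta, Matrix.cons_val_zero]
    rw [hd0v, map_zpow₀, hd.vϖ, ← WithZero.exp_zsmul, smul_eq_mul, mul_neg, mul_one, neg_neg]
  · simp only [Fin.mk_one, Matrix.cons_val_one, Matrix.cons_val_zero]
    rw [hd1, map_one]
  · simp only [Fin.reduceFinMk, Matrix.cons_val_two, Matrix.tail_cons, Matrix.head_cons, Nat.succ_eq_add_one]
    rw [hd2, neg_neg, map_zpow₀, hd.vϖ, ← WithZero.exp_zsmul, smul_eq_mul, mul_neg, mul_one]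

end Literature.NumberTheory.Automorphic.UnitaryLatticeTree

end
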